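import Literature.Geometry.Kaehler.ComplexTorusAbelianSurfaceEndomorphismAlgebras
import Literature.Geometry.Kaehler.ComplexTorusPicardNumberProduct
import Literature.NumberTheory.Automorphic.QuaternionInvolutionToolkit
import Mathlib.LinearAlgebra.Dual.Lemmas
import HarnessLib

/-!
# Shimura's restrictions on the endomorphism algebra of a simple abelian surface: no type III, no
# imaginary quadratic field (Hulek–Laface 2019, Prop. 5.1, exceptional cases (1), (3), (4) at `g = 2`)

Layer `Literature/Geometry/Kaehler`, namespace `Literature.Geometry.Kaehler.ComplexTorus`; lane
`lit-hodgefound` (Track 2 foundations library), row A2-32 «Albert classification» (seat p18 gen 9, row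
g9-#1).  THEOREMS ONLY (no definition, no named fact; D-0026, net debt 0).  Sequel of
`ComplexTorusAbelianSurfaceEndomorphismAlgebras.lean` (p12: Lange's §5.1.5 Exercise (2)(b) AS PRINTED — for a
simple abelian surface `End_ℚ(X)` is (i) `ℚ` or a real quadratic field, (ii) a totally definite OR totally
indefinite quaternion algebra over `ℚ`, (iii) a CM field of degree `2` or `4` — whose docstring records «Not
claimed (not in the exercise either): Shimura's finer statement that cases (ii)-definite and
(iii)-imaginary-quadratic do not occur for SIMPLE abelian surfaces»).  This file proves that finer statement.

## The print

K. Hulek, R. Laface, *On the Picard numbers of abelian varieties*, Ann. Sc. Norm. Super. Pisa (2019), §5.1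
(held text `paper:arxiv-1703.05882`, p0010), **Proposition 5.1** and its proof, VERBATIM: «Let `g` be a
fixed positive integer. For all positive integers `ρ` that satisfy one of the conditions above, there exists
a simple abelian variety `X` of the corresponding type such that `ρ(X) = ρ`, unless we are in one of the
five following exceptional cases: • `F` is of type III, and `m := g/2e = 1`; • `F` is of type III,
`m := g/2e = 2`, and […]; • `F` is of type IV, `Σ_{ν=1}^{e₀} r_ν s_ν = 0`; • `F` is of type IV,
`m := g/d²e₀ = 2`, `d = 1` and `r_ν = s_ν = 1` for all `ν = 1, …, e₀`; • `F` is of type IV, `m := g/d²e₀ = 1`,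
`d = 2` and `r_ν = s_ν = 1` […]. *Proof.* It is a theorem of Shimura that given an endomorphism structure
`(F, ′, ι)` one has that a general member `(X, H, ι)` of the moduli space `𝒜(ℳ, T)` has the property
`End_ℚ(X) = ι(F)`, except in the cases above (for example see [shimura63], or [birkenhake-lange04] for a
modern approach).  In fact, under the assumption that our abelian variety `X` be simple, one can show that
these cases never occur: • `X` is isogenous to a square `Y²`, where `Y` is an abelian variety of dimension
`e₀`, contradicting the fact that `X` is simple; • same argument as above; • `X` is isogenous to `Y^{d²m}`,
where `Y` is an abelian variety of dimension `e₀` […]; • `End_ℚ(X)` contains a totally indefinite quaternion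
algebra `F̃` over `K₀` with `F = K ⊂ F̃`, so that `F = K ⊂ F̃ ⊂ End_ℚ(X) = F`, contradiction; • as in (1) and
(2).»  At `g = 2` the cases concerning a SIMPLE surface are (1) (`e = 1`: `End_ℚ(X)` a definite quaternion
algebra over `ℚ`) and (3)/(4) (`e₀ = 1`, `d = 1`, `m = 2`: `End_ℚ(X) = K` an imaginary quadratic field, of
signature `(2,0)` resp. `(1,1)`).  The original is G. Shimura, *On analytic families of polarized abelian
varieties and automorphic functions*, Ann. of Math. 78 (1963) 149–192, §4 (paywalled here, acq-05438; cited
through Hulek–Laface).  The Picard-number values consumed: Hulek–Laface **Prop. 2.4** (p0006, VERBATIM):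
«Let `A` be a simple abelian variety. […] Then, for `k ≥ 1`, one has `ρ(Aᵏ) = ½ek(k+1)` (Type I),
`ek(2k+1)` (Type II), `ek(2k−1)` (Type III), `½ed²k²` (Type IV).»

## What is proved (for a simple polarised complex torus `X = E/Ψ(ℤ^κ)` of dimension `2`, `F = End_ℚ(X) =
endAlgRat Ψ`, centre `K = centerField Ψ hX`, Rosati involution `′ = rosatiEnd`)

* **`IsSimple.not_isTotallyDefinite_of_finrank_eq_two`**, **`IsSimple.not_isAlbertTypeIII_of_finrank_eq_two`**
  — case (1): `F` is not a totally definite quaternion algebra / `(F, ′)` is not of Albert type III;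
  `IsSimple.isTotallyIndefinite_of_finrank_eq_two` — if `[F : K] = 4` then `F` is totally indefinite and
  `ρ(X) = 3`.
* **`IsSimple.finrank_centerField_eq_four_of_isCMField_of_finrank_eq_two`** — cases (3)/(4): if the centre
  is a CM field then `[K : ℚ] = 4` and `F = K` (an imaginary quadratic `End_ℚ(X)` does not occur).
* **`IsSimple.endAlgRat_trichotomy_of_finrank_eq_two'`** — the Shimura-sharp form of Exercise (2)(b):
  (i) `F = K` totally real, `[K : ℚ] ∈ {1, 2}`; (ii) `K = ℚ`, `F` a totally indefinite quaternion algebra;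
  (iii) `F = K` a CM quartic field.
* **`IsSimple.finrank_neronSeveriGroup_and_finrank_endAlgRat_of_finrank_eq_two`** —
  `(ρ(X), dim_ℚ End_ℚ(X)) ∈ {(1,1), (2,2), (3,4), (2,4)}`;
  `IsSimple.finrank_endAlgRat_eq_one_of_finrank_neronSeveriGroup_eq_one` (`ρ = 1 ⇒ End_ℚ(X) = ℚ`);
  `IsSimple.finrank_neronSeveriGroup_eq_three_of_mul_self_eq_smul` (an imaginary quadratic
  multiplication forces `ρ = 3` and type II — case (4) as printed: "`End_ℚ(X)` contains a totally indefinite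
  quaternion algebra"); **`IsSimple.finrank_neronSeveriGroup_pow_of_finrank_eq_two`** — Prop. 2.4 at
  `dim A = 2` with the exclusions: `ρ(Xⁿ) ∈ {½n(n+1), n(n+1), n(2n+1), 2n²}`.

## Proof route (declared deviation: an elementary Picard-number argument, not Shimura's moduli count)

* §5 (algebra, `Literature.RingTheory.CentralSimple.IsPositiveAntiInvolution.…`): a positive anti-involution
  of a quaternion algebra over a centre with `[K : ℚ] = 1`, of the first kind, has a non-zero SKEW element
  `W` (`W′ = -W`) with `W² = q·1`, `q < 0` rational — `F` is not commutative so `′ ≠ id` and some `z - z′ ≠ 0`;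
  `W² = trd(W)W - nrd(W)` (`mul_self_eq_smul_sub`) and `(W²)′ = W²` force `trd W = 0`; positivity
  `Tr(W′W) = -q · dim_ℚ F > 0` gives the sign (`neg_of_apply_eq_neg_of_mul_self`).  Over a CM centre with
  `[K⁺ : ℚ] = 1`: `W = a - ā` (`exists_skew_mul_self_eq_smul_of_isCMField`).
* §3: if the complex structure `J` is a real multiple of `W` (`J = ±W/√(-q)`) then for a lattice vector `v`
  the plane `ℚv + ℚWv` is `W`-stable and its real span is a `J`-stable lattice plane: `X` is NOT simple
  (`not_isSimple_of_jMatrix_eq_smul`; case (3): "`X` is isogenous to `Y²`").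
* §1–§2: otherwise (`J ≠ ±I₀`, `I₀ = W/√(-q)`, `I₀² = -1`, `I₀J = JI₀`) every rational alternating form of
  «determinant type» — antisymmetric `G` with `ᵗW G = G W` — is `J`-invariant
  (`transpose_mul_mul_eq_of_commute_of_ne`: `ℝ⁴ = V₊ ⊕ V₋`, `V_± = {J = ±I₀}` are `I₀`-stable PLANES and such
  forms vanish on `V_± × V_±`), hence lies in the matrix model `nsGramQ` of `NS_ℚ(X)`
  (`mem_nsGramQ_of_transpose_mul_eq`); `D = ᵗW A + A W ≠ 0` for a suitable elementary alternating `A`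
  (`exists_transpose_mul_add_mul_ne_zero`, two separating functionals), and `ᵗW D` is again of determinant
  type.
* §4: the polarisation, `D` and `ᵗW D` are linearly independent (`J = ±I₀` has a non-zero eigenvector, where
  determinant-type forms vanish and the polarisation is positive; `c₁D + c₂ᵗWD = 0 ⇒ (c₁² - c₂²q)D = 0`), so
  `ρ(X) = dim_ℚ nsGramQ ≥ 3` (`IsSimple.three_le_finrank_nsGramQ_of_mul_self_eq_smul`,
  `IsSimple.three_le_finrank_neronSeveriGroup_of_mul_self_eq_smul`) — contradicting `ρ = e = 1` (type III,
  Lange's table line 3, p12's `finrank_neronSeveriGroup_eq_or_of_isQuaternionAlgebra`) resp. `ρ = e₀d² = 1`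
  (imaginary quadratic centre, `finrank_neronSeveriGroup_of_isCMField`).

`-- TODO(general form)`: Shimura's case (1) in every dimension `g = 2e` (`F` totally definite quaternion over
a totally real `K` of degree `e`, `m = 1`) by the same count `ρ ≥ 3e > e` needs `F ⊗ ℝ`; cases (2), (5) and the
moduli statement («a general member has `End_ℚ(X) = ι(F)`») are not treated.

## References

* [HulekLaface2019PicardNumbersAV] K. Hulek, R. Laface, *On the Picard numbers of abelian varieties*, Ann.
  Sc. Norm. Super. Pisa Cl. Sci. (5) XIX (2019), §5.1 Prop. 5.1 and proof (cases (1), (3), (4)); §2.2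
  Prop. 2.4, Cor. 2.5.
* [Shimura1963AnalyticFamilies] G. Shimura, *On analytic families of polarized abelian varieties and
  automorphic functions*, Ann. of Math. (2) 78 (1963), 149–192, §4.
* [Lange2023AbelianVarietiesComplex] H. Lange, *Abelian Varieties over the Complex Numbers* (2023), §2.6.1
  Proposition (table, p. 138), §2.6.2 Thm. 2.6.5, Lemma 2.6.6, §5.1.5 Exercise (2)(b) (p. 263).
* [MumfordAV1970] D. Mumford, *Abelian Varieties* (1970), §21, Thm. 2 and the remarks after the table.
-/

noncomputable section

open Module Matrix

namespace Literature.Geometry.Kaehler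

namespace ComplexTorus

/-! ## §1 Real linear algebra: two commuting complex structures on `ℝ⁴` and the alternating forms of
"determinant type" -/

section RealLinearAlgebra

variable {n : Type*} [Fintype n] [DecidableEq n]

omit [DecidableEq n] in
/-- `(A x) · (M y) = x · (ᵗA M y)`. [folklore] -/
private theorem mulVec_dotProduct_mulVec (A M : Matrix n n ℝ) (x y : n → ℝ) :
    (A *ᵥ x) ⬝ᵥ (M *ᵥ y) = x ⬝ᵥ ((Aᵀ * M) *ᵥ y) := by
  rw [← Matrix.mulVec_mulVec, Matrix.dotProduct_mulVec x Aᵀ, Matrix.vecMul_transpose]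

omit [DecidableEq n] in
/-- An antisymmetric matrix gives an antisymmetric form: `y · G x = -(x · G y)`. [folklore] -/
private theorem dotProduct_mulVec_swap {G : Matrix n n ℝ} (hG : Gᵀ = -G) (x y : n → ℝ) :
    y ⬝ᵥ (G *ᵥ x) = -(x ⬝ᵥ (G *ᵥ y)) := by
  rw [dotProduct_comm y, Matrix.dotProduct_mulVec x G, ← Matrix.vecMul_transpose, ← Matrix.dotProduct_mulVec,
    ← Matrix.dotProduct_mulVec, hG, Matrix.neg_mulVec, dotProduct_neg]

/-- A subspace stable under a complex structure `I₀` (`I₀² = -1`) is not one-dimensional. [folklore] -/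
private theorem finrank_ne_one_of_stable {I₀ : Matrix n n ℝ} (hI : I₀ * I₀ = -1) {S : Submodule ℝ (n → ℝ)}
    (hS : ∀ x ∈ S, I₀ *ᵥ x ∈ S) : finrank ℝ S ≠ 1 := by
  intro h1
  obtain ⟨v, hv, hgen⟩ := finrank_eq_one_iff'.1 h1
  obtain ⟨c, hc⟩ := hgen ⟨I₀ *ᵥ (v : n → ℝ), hS v v.2⟩
  have hc' : c • (v : n → ℝ) = I₀ *ᵥ (v : n → ℝ) := by
    simpa using congrArg Subtype.val hc
  have h2 : I₀ *ᵥ (I₀ *ᵥ (v : n → ℝ)) = -(v : n → ℝ) := by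
    rw [Matrix.mulVec_mulVec, hI, Matrix.neg_mulVec, Matrix.one_mulVec]
  rw [← hc', Matrix.mulVec_smul, ← hc', smul_smul] at h2
  have h3 : (c * c + 1) • (v : n → ℝ) = 0 := by rw [add_smul, one_smul, h2, neg_add_cancel]
  have hcc : c * c + 1 ≠ 0 := by nlinarith [mul_self_nonneg c]
  have hv0 : (v : n → ℝ) = 0 := (smul_eq_zero.1 h3).resolve_left hcc
  exact hv (Subtype.ext hv0)

/-- `a` and `I₀ a` are linearly independent for `a ≠ 0`. [folklore] -/
private theorem linearIndependent_pair_of_sq {I₀ : Matrix n n ℝ} (hI : I₀ * I₀ = -1) {a : n → ℝ}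
    (ha : a ≠ 0) : LinearIndependent ℝ ![a, I₀ *ᵥ a] := by
  refine LinearIndependent.pair_iff.2 fun s t hst ↦ ?_
  have h2 : I₀ *ᵥ (I₀ *ᵥ a) = -a := by
    rw [Matrix.mulVec_mulVec, hI, Matrix.neg_mulVec, Matrix.one_mulVec]
  have hst' : s • (I₀ *ᵥ a) - t • a = 0 := by
    have := congrArg (fun v ↦ I₀ *ᵥ v) hst
    rw [sub_eq_add_neg]
    simpa [Matrix.mulVec_add, Matrix.mulVec_smul, h2, Matrix.mulVec_zero] using this
  -- `s² a = -s t I₀ a = -t² a`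
  have hkey : (s * s + t * t) • a = 0 := by
    have e1 : s • (s • a + t • (I₀ *ᵥ a)) = 0 := by rw [hst, smul_zero]
    have e2 : t • (s • (I₀ *ᵥ a) - t • a) = 0 := by rw [hst', smul_zero]
    have : s • (s • a + t • (I₀ *ᵥ a)) - t • (s • (I₀ *ᵥ a) - t • a) = (s * s + t * t) • a := by
      simp only [smul_add, smul_sub, smul_smul, add_smul]
      rw [mul_comm t s]
      abel
    rw [← this, e1, e2, sub_zero]
  have hss : s * s + t * t = 0 := by
    by_contra h
    exact ha ((smul_eq_zero.1 hkey).resolve_left h)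
  constructor <;> nlinarith [mul_self_nonneg s, mul_self_nonneg t]

/-- An alternating form `g` with `g(x, I₀ x) = 0` vanishes identically on an `I₀`-stable plane. [folklore] -/
private theorem form_eq_zero_of_finrank_eq_two {I₀ G : Matrix n n ℝ} (hI : I₀ * I₀ = -1) (hGt : Gᵀ = -G)
    (hGI : ∀ x, x ⬝ᵥ (G *ᵥ (I₀ *ᵥ x)) = 0) {S : Submodule ℝ (n → ℝ)} (hS : ∀ x ∈ S, I₀ *ᵥ x ∈ S)
    (h2 : finrank ℝ S = 2) {u v : n → ℝ} (hu : u ∈ S) (hv : v ∈ S) : u ⬝ᵥ (G *ᵥ v) = 0 := by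
  classical
  -- a non-zero vector of `S` and the basis `a, I₀ a`
  have hSne : S ≠ ⊥ := by
    intro h; rw [h, finrank_bot] at h2; exact absurd h2 (by norm_num)
  obtain ⟨a, haS, ha0⟩ := S.ne_bot_iff.1 hSne
  have hli := linearIndependent_pair_of_sq hI ha0
  have hle : Submodule.span ℝ (Set.range ![a, I₀ *ᵥ a]) ≤ S := by
    rw [Submodule.span_le]
    rintro _ ⟨i, rfl⟩
    fin_cases i
    · exact haS
    · exact hS a haS
  haveI : FiniteDimensional ℝ S := Module.finite_of_finrank_eq_succ h2
  have heq : Submodule.span ℝ (Set.range ![a, I₀ *ᵥ a]) = S :=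
    Submodule.eq_of_le_of_finrank_eq hle (by rw [finrank_span_eq_card hli, h2]; simp)
  have hrange : Set.range ![a, I₀ *ᵥ a] = {a, I₀ *ᵥ a} := by
    ext z
    simp only [Set.mem_range, Set.mem_insert_iff, Set.mem_singleton_iff]
    constructor
    · rintro ⟨i, rfl⟩; fin_cases i <;> simp
    · rintro (rfl | rfl); exacts [⟨0, rfl⟩, ⟨1, rfl⟩]
  rw [← heq, hrange] at hu hv
  obtain ⟨α, β, rfl⟩ := Submodule.mem_span_pair.1 hu
  obtain ⟨γ, δ, rfl⟩ := Submodule.mem_span_pair.1 hv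
  -- the four values
  have g_aa : a ⬝ᵥ (G *ᵥ a) = 0 := by
    have := dotProduct_mulVec_swap hGt a a; linarith
  have g_aI : a ⬝ᵥ (G *ᵥ (I₀ *ᵥ a)) = 0 := hGI a
  have g_Ia : (I₀ *ᵥ a) ⬝ᵥ (G *ᵥ a) = 0 := by rw [dotProduct_mulVec_swap hGt, g_aI, neg_zero]
  have g_II : (I₀ *ᵥ a) ⬝ᵥ (G *ᵥ (I₀ *ᵥ a)) = 0 := by
    have := dotProduct_mulVec_swap hGt (I₀ *ᵥ a) (I₀ *ᵥ a); linarith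
  simp only [Matrix.mulVec_add, Matrix.mulVec_smul, dotProduct_add, dotProduct_smul, add_dotProduct,
    smul_dotProduct, g_aa, g_aI, g_Ia, g_II, smul_eq_mul, mul_zero, add_zero]

/-- **Two commuting complex structures and the alternating forms of determinant type.**  On `ℝ⁴` let
`I₀, J` be complex structures (`I₀² = J² = -1`) which commute, and `G` an antisymmetric matrix with
`ᵗI₀ G = G I₀` (the form `g(x, y) = ᵗx G y` satisfies `g(I₀ x, y) = g(x, I₀ y)`).  If `J ≠ ±I₀` then `g` is
`J`-invariant: `ᵗJ G J = G`.  (The eigenspaces `V_± = {J = ±I₀}` are `I₀`-stable planes with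
`ℝ⁴ = V₊ ⊕ V₋`; `g` vanishes on `V_± × V_±` because `g(x, I₀ x) = 0`, and `J = ±I₀` on `V_±`.) [folklore] -/
private theorem transpose_mul_mul_eq_of_commute_of_ne {I₀ J G : Matrix n n ℝ} (h4 : Fintype.card n = 4)
    (hI : I₀ * I₀ = -1) (hJ : J * J = -1) (hc : I₀ * J = J * I₀) (hGt : Gᵀ = -G) (hGI : I₀ᵀ * G = G * I₀)
    (h₁ : J ≠ I₀) (h₂ : J ≠ -I₀) : Jᵀ * G * J = G := by
  classical
  -- the form and its symmetries
  have gI : ∀ x y, (I₀ *ᵥ x) ⬝ᵥ (G *ᵥ y) = x ⬝ᵥ (G *ᵥ (I₀ *ᵥ y)) := fun x y ↦ by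
    rw [mulVec_dotProduct_mulVec, hGI, ← Matrix.mulVec_mulVec]
  have I0I0 : ∀ x, I₀ *ᵥ (I₀ *ᵥ x) = -x := fun x ↦ by
    rw [Matrix.mulVec_mulVec, hI, Matrix.neg_mulVec, Matrix.one_mulVec]
  have gII : ∀ x y, (I₀ *ᵥ x) ⬝ᵥ (G *ᵥ (I₀ *ᵥ y)) = -(x ⬝ᵥ (G *ᵥ y)) := fun x y ↦ by
    rw [gI, I0I0, Matrix.mulVec_neg, dotProduct_neg]
  have gxI : ∀ x, x ⬝ᵥ (G *ᵥ (I₀ *ᵥ x)) = 0 := fun x ↦ by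
    have h := dotProduct_mulVec_swap hGt x (I₀ *ᵥ x)
    rw [gI] at h
    linarith
  -- the eigenspaces
  let Vp : Submodule ℝ (n → ℝ) := LinearMap.ker (Matrix.toLin' (J - I₀))
  let Vm : Submodule ℝ (n → ℝ) := LinearMap.ker (Matrix.toLin' (J + I₀))
  have memVp : ∀ x, x ∈ Vp ↔ J *ᵥ x = I₀ *ᵥ x := fun x ↦ by
    simp only [Vp, LinearMap.mem_ker, Matrix.toLin'_apply, Matrix.sub_mulVec, sub_eq_zero]
  have memVm : ∀ x, x ∈ Vm ↔ J *ᵥ x = -(I₀ *ᵥ x) := fun x ↦ by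
    simp only [Vm, LinearMap.mem_ker, Matrix.toLin'_apply, Matrix.add_mulVec, add_eq_zero_iff_eq_neg]
  have JJ : ∀ x, J *ᵥ (J *ᵥ x) = -x := fun x ↦ by
    rw [Matrix.mulVec_mulVec, hJ, Matrix.neg_mulVec, Matrix.one_mulVec]
  have JI : ∀ x, J *ᵥ (I₀ *ᵥ x) = I₀ *ᵥ (J *ᵥ x) := fun x ↦ by
    rw [Matrix.mulVec_mulVec, Matrix.mulVec_mulVec, hc]
  -- the projections `x = x₊ + x₋`
  let pp : (n → ℝ) → (n → ℝ) := fun x ↦ (2 : ℝ)⁻¹ • (x - I₀ *ᵥ (J *ᵥ x))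
  let pm : (n → ℝ) → (n → ℝ) := fun x ↦ (2 : ℝ)⁻¹ • (x + I₀ *ᵥ (J *ᵥ x))
  have pp_mem : ∀ x, pp x ∈ Vp := fun x ↦ by
    rw [memVp]
    simp only [pp, Matrix.mulVec_smul, Matrix.mulVec_sub, JI, JJ, I0I0, Matrix.mulVec_neg]
    congr 1
    abel
  have pm_mem : ∀ x, pm x ∈ Vm := fun x ↦ by
    rw [memVm]
    simp only [pm, Matrix.mulVec_smul, Matrix.mulVec_add, JI, JJ, I0I0, Matrix.mulVec_neg, ← smul_neg]
    congr 1
    abel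
  have decomp : ∀ x, pp x + pm x = x := fun x ↦ by
    simp only [pp, pm, ← smul_add]
    rw [show x - I₀ *ᵥ (J *ᵥ x) + (x + I₀ *ᵥ (J *ᵥ x)) = (2 : ℝ) • x by rw [two_smul]; abel, smul_smul]
    norm_num
  -- stability under `I₀`
  have Vp_st : ∀ x ∈ Vp, I₀ *ᵥ x ∈ Vp := fun x hx ↦ by
    rw [memVp] at hx ⊢; rw [JI, hx]
  have Vm_st : ∀ x ∈ Vm, I₀ *ᵥ x ∈ Vm := fun x hx ↦ by
    rw [memVm] at hx ⊢; rw [JI, hx, Matrix.mulVec_neg]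
  -- `Vp ⊓ Vm = ⊥`, `Vp ⊔ Vm = ⊤`
  have hinf : Vp ⊓ Vm = ⊥ := by
    rw [eq_bot_iff]
    intro x hx
    obtain ⟨hp, hm⟩ := Submodule.mem_inf.1 hx
    rw [memVp] at hp; rw [memVm] at hm
    have h0 : I₀ *ᵥ x = 0 := by
      have : (2 : ℝ) • (I₀ *ᵥ x) = 0 := by rw [two_smul]; nth_rewrite 1 [← hp]; rw [hm, neg_add_cancel]
      exact (smul_eq_zero.1 this).resolve_left two_ne_zero
    have : x = -(I₀ *ᵥ (I₀ *ᵥ x)) := by rw [I0I0, neg_neg]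
    rw [Submodule.mem_bot, this, h0, Matrix.mulVec_zero, neg_zero]
  have hsup : Vp ⊔ Vm = ⊤ := by
    rw [eq_top_iff]
    intro x _
    rw [← decomp x]
    exact Submodule.add_mem_sup (pp_mem x) (pm_mem x)
  have hdim : finrank ℝ Vp + finrank ℝ Vm = 4 := by
    have h := Submodule.finrank_sup_add_finrank_inf_eq Vp Vm
    rw [hinf, hsup, finrank_bot, finrank_top, Module.finrank_fintype_fun_eq_card, h4] at h
    omega
  -- neither is trivial
  have ext_of_forall : ∀ {A B : Matrix n n ℝ}, (∀ x, A *ᵥ x = B *ᵥ x) → A = B := fun h ↦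
    Matrix.toLin'.injective (LinearMap.ext fun x ↦ by rw [Matrix.toLin'_apply, Matrix.toLin'_apply, h])
  have hVp : Vp ≠ ⊥ := by
    intro h
    apply h₂
    refine ext_of_forall fun x ↦ ?_
    have hx : pp x = 0 := by simpa [h] using pp_mem x
    have : x ∈ Vm := by rw [← decomp x, hx, zero_add]; exact pm_mem x
    rw [memVm] at this
    rw [this, Matrix.neg_mulVec]
  have hVm : Vm ≠ ⊥ := by
    intro h
    apply h₁
    refine ext_of_forall fun x ↦ ?_
    have hx : pm x = 0 := by simpa [h] using pm_mem x
    have : x ∈ Vp := by rw [← decomp x, hx, add_zero]; exact pp_mem x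
    exact (memVp x).1 this
  have hp0 : finrank ℝ Vp ≠ 0 := fun h ↦ hVp (Submodule.finrank_eq_zero.1 h)
  have hm0 : finrank ℝ Vm ≠ 0 := fun h ↦ hVm (Submodule.finrank_eq_zero.1 h)
  have hp1 := finrank_ne_one_of_stable hI Vp_st
  have hm1 := finrank_ne_one_of_stable hI Vm_st
  have hp2 : finrank ℝ Vp = 2 := by omega
  have hm2 : finrank ℝ Vm = 2 := by omega
  -- `g` vanishes on `Vp × Vp` and `Vm × Vm`
  have gp : ∀ u ∈ Vp, ∀ v ∈ Vp, u ⬝ᵥ (G *ᵥ v) = 0 := fun u hu v hv ↦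
    form_eq_zero_of_finrank_eq_two hI hGt gxI Vp_st hp2 hu hv
  have gm : ∀ u ∈ Vm, ∀ v ∈ Vm, u ⬝ᵥ (G *ᵥ v) = 0 := fun u hu v hv ↦
    form_eq_zero_of_finrank_eq_two hI hGt gxI Vm_st hm2 hu hv
  -- the form identity
  have key : ∀ x y, (J *ᵥ x) ⬝ᵥ (G *ᵥ (J *ᵥ y)) = x ⬝ᵥ (G *ᵥ y) := by
    intro x y
    have hJx : J *ᵥ x = I₀ *ᵥ (pp x - pm x) := by
      conv_lhs => rw [← decomp x]
      rw [Matrix.mulVec_add, (memVp _).1 (pp_mem x), (memVm _).1 (pm_mem x), Matrix.mulVec_sub]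
      abel
    have hJy : J *ᵥ y = I₀ *ᵥ (pp y - pm y) := by
      conv_lhs => rw [← decomp y]
      rw [Matrix.mulVec_add, (memVp _).1 (pp_mem y), (memVm _).1 (pm_mem y), Matrix.mulVec_sub]
      abel
    rw [hJx, hJy, gII]
    conv_rhs => rw [← decomp x, ← decomp y]
    simp only [Matrix.mulVec_sub, Matrix.mulVec_add, dotProduct_sub, dotProduct_add, sub_dotProduct,
      add_dotProduct, gp _ (pp_mem x) _ (pp_mem y), gm _ (pm_mem x) _ (pm_mem y)]
    ring
  -- back to matrices
  refine Matrix.toBilin'.injective (LinearMap.ext₂ fun x y ↦ ?_)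
  rw [Matrix.toBilin'_apply', Matrix.toBilin'_apply', ← Matrix.mulVec_mulVec, ← Matrix.mulVec_mulVec,
    Matrix.dotProduct_mulVec x Jᵀ, Matrix.vecMul_transpose, key]

/-- For two commuting complex structures on a non-zero space some non-zero vector lies in one of the
two eigenspaces `{J = I₀}`, `{J = -I₀}`. [folklore] -/
private theorem exists_ne_zero_mulVec_eq_or {I₀ J : Matrix n n ℝ} [Nonempty n] (hI : I₀ * I₀ = -1)
    (hJ : J * J = -1) (hc : I₀ * J = J * I₀) :
    ∃ x : n → ℝ, x ≠ 0 ∧ (J *ᵥ x = I₀ *ᵥ x ∨ J *ᵥ x = -(I₀ *ᵥ x)) := by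
  classical
  obtain ⟨i₀⟩ := ‹Nonempty n›
  let y : n → ℝ := Pi.single i₀ 1
  have hy : y ≠ 0 := by
    intro h; have := congrFun h i₀; simp [y] at this
  have JJ : J *ᵥ (J *ᵥ y) = -y := by rw [Matrix.mulVec_mulVec, hJ, Matrix.neg_mulVec, Matrix.one_mulVec]
  have I0I0 : ∀ x, I₀ *ᵥ (I₀ *ᵥ x) = -x := fun x ↦ by
    rw [Matrix.mulVec_mulVec, hI, Matrix.neg_mulVec, Matrix.one_mulVec]
  have JI : ∀ x, J *ᵥ (I₀ *ᵥ x) = I₀ *ᵥ (J *ᵥ x) := fun x ↦ by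
    rw [Matrix.mulVec_mulVec, Matrix.mulVec_mulVec, hc]
  by_cases hp : y - I₀ *ᵥ (J *ᵥ y) = 0
  · -- then `y ∈ V₋`
    refine ⟨y, hy, Or.inr ?_⟩
    have h1 : y = I₀ *ᵥ (J *ᵥ y) := sub_eq_zero.1 hp
    have h2 : I₀ *ᵥ y = -(J *ᵥ y) := by
      conv_lhs => rw [h1]
      rw [I0I0]
    rw [h2, neg_neg]
  · refine ⟨y - I₀ *ᵥ (J *ᵥ y), hp, Or.inl ?_⟩
    rw [Matrix.mulVec_sub, Matrix.mulVec_sub, JI, JJ, I0I0, Matrix.mulVec_neg]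
    abel

end RealLinearAlgebra

/-! ## §2 Rational alternating forms of determinant type attached to an imaginary quadratic
multiplication `W ∈ End_ℚ(X)`, `W² = q < 0` -/

section Rational

variable {κ : Type*} [Fintype κ] [DecidableEq κ] {E : Type*} [NormedAddCommGroup E] [NormedSpace ℂ E]
  (Ψ : (κ → ℝ) ≃L[ℝ] E)

omit [DecidableEq κ] in
/-- Casts of products of rational matrices. [folklore] -/
private theorem map_ratCast_mul (A B : Matrix κ κ ℚ) :
    (A * B).map (Rat.cast : ℚ → ℝ) = A.map (Rat.cast : ℚ → ℝ) * B.map (Rat.cast : ℚ → ℝ) :=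
  Matrix.map_mul (f := Rat.castHom ℝ)

omit [Fintype κ] [DecidableEq κ] in
/-- Casts of rational scalar multiples. [folklore] -/
private theorem map_ratCast_smul (c : ℚ) (A : Matrix κ κ ℚ) :
    (c • A).map (Rat.cast : ℚ → ℝ) = (c : ℝ) • A.map (Rat.cast : ℚ → ℝ) := by
  ext i j; simp

/-- **The normalised complex structure `I₀ = W/√(-q)` of an imaginary quadratic multiplication.**  For a
rational matrix `W` commuting with `J` with `W² = q·1`, `q < 0`, the real matrix
`I₀ = (√(-q))⁻¹ W` satisfies `I₀² = -1` and commutes with `J`. [folklore] -/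
private theorem sq_normalise_eq_neg_one {W : Matrix κ κ ℚ} {q : ℚ} (hq : q < 0) (hWW : W * W = q • 1) :
    ((Real.sqrt (-q))⁻¹ • W.map (Rat.cast : ℚ → ℝ)) * ((Real.sqrt (-q))⁻¹ • W.map (Rat.cast : ℚ → ℝ)) = -1 := by
  have hs : Real.sqrt (-(q : ℝ)) ^ 2 = -(q : ℝ) := Real.sq_sqrt (by exact_mod_cast (neg_pos.2 hq).le)
  have hq0 : (q : ℝ) ≠ 0 := by exact_mod_cast hq.ne
  rw [Matrix.smul_mul, Matrix.mul_smul, smul_smul, ← map_ratCast_mul, hWW, map_ratCast_smul,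
    Matrix.map_one Rat.cast Rat.cast_zero Rat.cast_one, smul_smul, ← mul_inv, ← pow_two, hs, inv_neg, neg_mul,
    inv_mul_cancel₀ hq0, neg_smul, one_smul]

/-- **An alternating form of determinant type is a Néron–Severi class off the CM locus.**  Let
`W ∈ End_ℚ(X)` with `W² = q·1`, `q < 0`, on a complex torus `X = E/Ψ(ℤ^κ)` of dimension `2`
(`|κ| = 4`), and suppose the complex structure `J` is neither `W/√(-q)` nor `-W/√(-q)`.  Then every
rational antisymmetric `G` with `ᵗW G = G W` (the alternating forms `g` with `g(Wx, y) = g(x, Wy)` —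
"`K`-bilinear", `K = ℚ(W)`) is `J`-invariant, i.e. lies in the matrix model `nsGramQ` of `NS_ℚ(X)`.
[cite: HulekLaface2019PicardNumbersAV, §5.1 Prop. 5.1, case (4) of the proof ("`End_ℚ(X)` contains a totally indefinite quaternion algebra")] -/
theorem mem_nsGramQ_of_transpose_mul_eq (h4 : Fintype.card κ = 4) {W : Matrix κ κ ℚ} (hW : W ∈ endAlgRat Ψ)
    {q : ℚ} (hq : q < 0) (hWW : W * W = q • 1)
    (h₁ : jMatrix Ψ ≠ (Real.sqrt (-q))⁻¹ • W.map (Rat.cast : ℚ → ℝ))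
    (h₂ : jMatrix Ψ ≠ -((Real.sqrt (-q))⁻¹ • W.map (Rat.cast : ℚ → ℝ)))
    {G : Matrix κ κ ℚ} (hGt : Gᵀ = -G) (hGW : Wᵀ * G = G * W) : G ∈ nsGramQ Ψ := by
  refine ⟨hGt, ?_⟩
  set I₀ := (Real.sqrt (-q))⁻¹ • W.map (Rat.cast : ℚ → ℝ) with hI₀
  have hI : I₀ * I₀ = -1 := sq_normalise_eq_neg_one hq hWW
  have hc : I₀ * jMatrix Ψ = jMatrix Ψ * I₀ := by
    rw [hI₀, Matrix.smul_mul, Matrix.mul_smul, (mem_endAlgRat_iff Ψ W).1 hW]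
  have hGt' : (G.map (Rat.cast : ℚ → ℝ))ᵀ = -G.map (Rat.cast : ℚ → ℝ) := by
    rw [← Matrix.transpose_map, hGt, Matrix.map_neg _ Rat.cast_neg]
  have hGI : I₀ᵀ * G.map (Rat.cast : ℚ → ℝ) = G.map (Rat.cast : ℚ → ℝ) * I₀ := by
    rw [hI₀, Matrix.transpose_smul, Matrix.smul_mul, Matrix.mul_smul, ← Matrix.transpose_map,
      ← map_ratCast_mul, hGW, map_ratCast_mul]
  exact transpose_mul_mul_eq_of_commute_of_ne h4 hI (jMatrix_mul_jMatrix Ψ) hc hGt' hGI h₁ h₂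

/-- The determinant-type form `D_A = ᵗW A + A W` of an alternating `A`: it is alternating and satisfies
`ᵗW D = D W` whenever `W² = q·1`. [folklore] -/
private theorem transpose_mul_add_mul_props {W A : Matrix κ κ ℚ} {q : ℚ} (hWW : W * W = q • 1) (hA : Aᵀ = -A) :
    (Wᵀ * A + A * W)ᵀ = -(Wᵀ * A + A * W) ∧ Wᵀ * (Wᵀ * A + A * W) = (Wᵀ * A + A * W) * W := by
  have hWt : Wᵀ * Wᵀ = q • 1 := by rw [← Matrix.transpose_mul, hWW, Matrix.transpose_smul, Matrix.transpose_one]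
  constructor
  · rw [Matrix.transpose_add, Matrix.transpose_mul, Matrix.transpose_mul, Matrix.transpose_transpose, hA]
    simp only [Matrix.neg_mul, Matrix.mul_neg, neg_add_rev]
  · rw [Matrix.mul_add, Matrix.add_mul, ← Matrix.mul_assoc, hWt, Matrix.mul_assoc A, hWW,
      Matrix.smul_mul, Matrix.mul_smul, Matrix.one_mul, Matrix.mul_one, Matrix.mul_assoc, add_comm]

/-- The companion `D' = ᵗW D` of a determinant-type form `D` (`ᵗD = -D`, `ᵗW D = D W`) is again of
determinant type. [folklore] -/
private theorem transpose_mul_props {W D : Matrix κ κ ℚ} {q : ℚ} (hWW : W * W = q • 1) (hD : Dᵀ = -D)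
    (hDW : Wᵀ * D = D * W) : (Wᵀ * D)ᵀ = -(Wᵀ * D) ∧ Wᵀ * (Wᵀ * D) = (Wᵀ * D) * W := by
  have hWt : Wᵀ * Wᵀ = q • 1 := by rw [← Matrix.transpose_mul, hWW, Matrix.transpose_smul, Matrix.transpose_one]
  constructor
  · rw [Matrix.transpose_mul, Matrix.transpose_transpose, hD, Matrix.neg_mul, ← hDW]
  · rw [← Matrix.mul_assoc, hWt, Matrix.mul_assoc, ← hDW, ← Matrix.mul_assoc, hWt]

/-- A linear functional on `ℚ^κ` is a dot product. [folklore] -/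
private theorem dual_apply_eq_dotProduct (f : Module.Dual ℚ (κ → ℚ)) (x : κ → ℚ) :
    f x = x ⬝ᵥ fun i ↦ f (Pi.single i 1) := by
  conv_lhs => rw [← Finset.univ_sum_single x, map_sum]
  simp only [dotProduct]
  refine Finset.sum_congr rfl fun i _ ↦ ?_
  rw [show Pi.single i (x i) = x i • (Pi.single i (1 : ℚ) : κ → ℚ) by
    rw [← Pi.single_smul, smul_eq_mul, mul_one], map_smul, smul_eq_mul]

omit [DecidableEq κ] in
/-- The bilinear form of `vecMulVec a b - vecMulVec b a`: `(x·a)(b·y) - (x·b)(a·y)`. [folklore] -/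
private theorem dotProduct_wedge_mulVec (a b x y : κ → ℚ) :
    x ⬝ᵥ ((Matrix.vecMulVec a b - Matrix.vecMulVec b a) *ᵥ y) = (x ⬝ᵥ a) * (b ⬝ᵥ y) - (x ⬝ᵥ b) * (a ⬝ᵥ y) := by
  rw [Matrix.sub_mulVec, Matrix.vecMulVec_mulVec, Matrix.vecMulVec_mulVec, dotProduct_sub]
  simp only [op_smul_eq_smul, dotProduct_smul, smul_eq_mul]
  ring

/-- **Existence of a non-zero form of determinant type** on `ℚ⁴ ⊇ K v ⊕ K u`: for `W` with
`W² = q·1`, `q < 0`, on `ℚ^κ`, `|κ| = 4`, there is an alternating rational `A` with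
`D = ᵗW A + A W ≠ 0`. [folklore] -/
private theorem exists_transpose_mul_add_mul_ne_zero (h4 : Fintype.card κ = 4) {W : Matrix κ κ ℚ} {q : ℚ}
    (hq : q < 0) (hWW : W * W = q • 1) :
    ∃ A : Matrix κ κ ℚ, Aᵀ = -A ∧ Wᵀ * A + A * W ≠ 0 := by
  classical
  have hne : Nonempty κ := Fintype.card_pos_iff.1 (by omega)
  obtain ⟨i₀⟩ := hne
  let v : κ → ℚ := Pi.single i₀ 1
  have hv : v ≠ 0 := by intro h; have := congrFun h i₀; simp [v] at this
  have WWv : ∀ x, W *ᵥ (W *ᵥ x) = q • x := fun x ↦ by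
    rw [Matrix.mulVec_mulVec, hWW, Matrix.smul_mulVec, Matrix.one_mulVec]
  -- `v ∉ ℚ · W v`
  have hv1 : v ∉ Submodule.span ℚ ({W *ᵥ v} : Set (κ → ℚ)) := by
    intro h
    obtain ⟨c, hc⟩ := Submodule.mem_span_singleton.1 h
    have h1 : W *ᵥ v = (c * q) • v := by
      have := congrArg (fun x ↦ W *ᵥ x) hc
      simp only [Matrix.mulVec_smul, WWv, smul_smul] at this
      exact this.symm
    have h2 : (1 - c * (c * q)) • v = 0 := by rw [sub_smul, one_smul, ← smul_smul, ← h1, hc, sub_self]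
    have h3 : 1 - c * (c * q) ≠ 0 := by nlinarith [mul_self_nonneg c]
    exact hv ((smul_eq_zero.1 h2).resolve_left h3)
  obtain ⟨f, hfv, hfW⟩ := Submodule.exists_dual_map_eq_bot_of_notMem (R := ℚ) (M := κ → ℚ) hv1
    Module.Projective.of_free
  have hfWv : f (W *ᵥ v) = 0 := by
    have : f (W *ᵥ v) ∈ Submodule.map f (Submodule.span ℚ {W *ᵥ v}) :=
      Submodule.mem_map_of_mem (Submodule.subset_span rfl)
    rw [hfW, Submodule.mem_bot] at this; exact this
  -- `u ∉ ℚ v + ℚ W v`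
  let p : Submodule ℚ (κ → ℚ) := Submodule.span ℚ {v, W *ᵥ v}
  have hp : p ≠ ⊤ := by
    intro h
    have h2 : finrank ℚ p ≤ 2 := by
      have := finrank_span_finset_le_card (R := ℚ) ({v, W *ᵥ v} : Finset (κ → ℚ))
      rw [Finset.coe_pair] at this
      exact this.trans Finset.card_le_two
    rw [h, finrank_top, Module.finrank_fintype_fun_eq_card, h4] at h2
    omega
  obtain ⟨u, -, hu⟩ := SetLike.exists_of_lt (lt_top_iff_ne_top.2 hp)
  obtain ⟨g, hgu, hgp⟩ := Submodule.exists_dual_map_eq_bot_of_notMem (R := ℚ) (M := κ → ℚ) hu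
    Module.Projective.of_free
  have hg0 : ∀ x ∈ p, g x = 0 := fun x hx ↦ by
    have : g x ∈ Submodule.map g p := Submodule.mem_map_of_mem hx
    rw [hgp, Submodule.mem_bot] at this; exact this
  have hgv : g v = 0 := hg0 v (Submodule.subset_span (by simp))
  have hgWv : g (W *ᵥ v) = 0 := hg0 _ (Submodule.subset_span (by simp))
  -- the vectors of `f`, `g` and the alternating matrix
  let a : κ → ℚ := fun i ↦ f (Pi.single i 1)
  let b : κ → ℚ := fun i ↦ g (Pi.single i 1)
  have hfa : ∀ x, f x = x ⬝ᵥ a := dual_apply_eq_dotProduct f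
  have hgb : ∀ x, g x = x ⬝ᵥ b := dual_apply_eq_dotProduct g
  refine ⟨Matrix.vecMulVec a b - Matrix.vecMulVec b a, ?_, fun hD ↦ ?_⟩
  · rw [Matrix.transpose_sub, Matrix.transpose_vecMulVec, Matrix.transpose_vecMulVec, neg_sub]
  · -- evaluate at `(v, W u)`
    have hval : v ⬝ᵥ ((Wᵀ * (Matrix.vecMulVec a b - Matrix.vecMulVec b a) +
        (Matrix.vecMulVec a b - Matrix.vecMulVec b a) * W) *ᵥ (W *ᵥ u)) = q * (f v * g u) := by
      rw [Matrix.add_mulVec, dotProduct_add, ← Matrix.mulVec_mulVec, ← Matrix.mulVec_mulVec,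
        Matrix.dotProduct_mulVec v Wᵀ, Matrix.vecMul_transpose, dotProduct_wedge_mulVec,
        dotProduct_wedge_mulVec, WWv, dotProduct_smul, dotProduct_smul]
      have e1 : (W *ᵥ v) ⬝ᵥ a = 0 := by rw [← hfa]; exact hfWv
      have e2 : (W *ᵥ v) ⬝ᵥ b = 0 := by rw [← hgb]; exact hgWv
      have e3 : v ⬝ᵥ b = 0 := by rw [← hgb]; exact hgv
      rw [e1, e2, e3, ← hfa, dotProduct_comm b u, ← hgb]
      simp only [smul_eq_mul]; ring
    rw [hD, Matrix.zero_mulVec, dotProduct_zero] at hval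
    have : q * (f v * g u) ≠ 0 := mul_ne_zero hq.ne (mul_ne_zero hfv hgu)
    exact this hval.symm

/-! ## §3 On the CM locus `J = ±W/√(-q)` the torus is not simple -/

/-- **If the complex structure is a real multiple of a rational endomorphism `W` with `W² = q·1`, the torus
of dimension `≥ 2` is not simple**: for a lattice vector `v`, the rational plane `ℚv + ℚWv` is
`W`-stable, so its real span is a `J`-stable lattice plane — a one-dimensional complex subtorus (the case
`Σ r_ν s_ν = 0` of Shimura's list: "`X` is isogenous to `Y^{d²m}` where `Y` is an abelian variety of
dimension `e₀`", here an elliptic curve with complex multiplication by `ℚ(W)`).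
[cite: HulekLaface2019PicardNumbersAV, §5.1 Prop. 5.1, case (3) of the proof] -/
theorem not_isSimple_of_jMatrix_eq_smul {W : Matrix κ κ ℚ} {q : ℚ} (hWW : W * W = q • 1) {c : ℝ}
    (hJ : jMatrix Ψ = c • W.map (Rat.cast : ℚ → ℝ)) (hκ : 2 < Fintype.card κ) : ¬ IsSimple Ψ := by
  classical
  intro hX
  have hne : Nonempty κ := Fintype.card_pos_iff.1 (by omega)
  obtain ⟨i₀⟩ := hne
  let v : κ → ℚ := Pi.single i₀ 1
  have hv : v ≠ 0 := by intro h; have := congrFun h i₀; simp [v] at this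
  let N : Submodule ℚ (κ → ℚ) := Submodule.span ℚ {v, W *ᵥ v}
  have hvN : v ∈ N := Submodule.subset_span (by simp)
  have hWvN : W *ᵥ v ∈ N := Submodule.subset_span (by simp)
  -- `N` is `W`-stable
  have hN : ∀ x ∈ N, W *ᵥ x ∈ N := by
    intro x hx
    obtain ⟨a, b, rfl⟩ := Submodule.mem_span_pair.1 hx
    rw [Matrix.mulVec_add, Matrix.mulVec_smul, Matrix.mulVec_smul, Matrix.mulVec_mulVec, hWW,
      Matrix.smul_mulVec, Matrix.one_mulVec]
    exact N.add_mem (N.smul_mem a hWvN) (N.smul_mem b (N.smul_mem q hvN))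
  -- the real span is `W`-stable, hence `J`-stable
  have hNR : ∀ x ∈ realSpan N, W.map (Rat.cast : ℚ → ℝ) *ᵥ x ∈ realSpan N := by
    intro x hx
    induction hx using Submodule.span_induction with
    | mem y hy =>
      obtain ⟨n, hn, rfl⟩ := hy
      rw [map_ratCast_mulVec_ratVec]
      exact ratVec_mem_realSpan (hN n hn)
    | zero => rw [Matrix.mulVec_zero]; exact Submodule.zero_mem _
    | add y z _ _ hy hz => rw [Matrix.mulVec_add]; exact Submodule.add_mem _ hy hz
    | smul r y _ hy => rw [Matrix.mulVec_smul]; exact Submodule.smul_mem _ r hy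
  have hcx : IsComplexSubspace Ψ (realSpan N) := by
    intro x hx
    have h : Ψ.symm (Complex.I • Ψ x) = c • (W.map (Rat.cast : ℚ → ℝ) *ᵥ x) := by
      rw [← latticeJ_apply, ← jMatrix_mulVec, hJ, Matrix.smul_mulVec]
    rw [h]
    exact Submodule.smul_mem _ c (hNR x hx)
  rcases hX (realSpan N) (isLatticeSubspace_realSpan N) hcx with h | h
  · -- `realSpan N ≠ ⊥`
    have hvR : ratVec v ∈ realSpan N := ratVec_mem_realSpan hvN
    rw [h, Submodule.mem_bot] at hvR
    exact hv (ratVec_injective (by rw [hvR, ratVec_zero]))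
  · -- `realSpan N ≠ ⊤`: its dimension is at most `2`
    have h2 : finrank ℝ (realSpan N) ≤ 2 := by
      rw [finrank_realSpan]
      have := finrank_span_finset_le_card (R := ℚ) ({v, W *ᵥ v} : Finset (κ → ℚ))
      rw [Finset.coe_pair] at this
      exact this.trans Finset.card_le_two
    rw [h, finrank_top, Module.finrank_fintype_fun_eq_card] at h2
    omega

/-! ## §4 Three independent Néron–Severi classes: `ρ(X) ≥ 3` for a simple abelian surface with an
imaginary quadratic multiplication -/

/-- **A simple polarised complex torus of dimension `2` whose endomorphism algebra contains `W` with
`W² = q < 0` (an embedding `ℚ(√q) ↪ End_ℚ(X)`) has Picard number `ρ(X) ≥ 3`** (matrix form: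
`dim_ℚ nsGramQ ≥ 3`).  The three classes: the polarisation, a non-zero form `D` of determinant type and its
companion `ᵗW D`; simplicity excludes the CM locus `J = ±W/√(-q)` (§3), off which the determinant-type
forms are `J`-invariant (§1–§2); independence: the polarisation is positive on an eigenvector of `J = ±I₀`
where determinant-type forms vanish, and `c₁ D + c₂ ᵗW D = 0` forces `(c₁² - c₂² q) D = 0`.
[cite: HulekLaface2019PicardNumbersAV, §5.1 Prop. 5.1, cases (1), (3), (4) of the proof] -/
theorem IsSimple.three_le_finrank_nsGramQ_of_mul_self_eq_smul {η : E [⋀^Fin 2]→L[ℝ] ℝ} (hX : IsSimple Ψ)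
    (hη : IsRiemannForm Ψ η) (h4 : Fintype.card κ = 4) {W : Matrix κ κ ℚ} (hW : W ∈ endAlgRat Ψ) {q : ℚ}
    (hq : q < 0) (hWW : W * W = q • 1) : 3 ≤ finrank ℚ (nsGramQ Ψ) := by
  classical
  have hne : Nonempty κ := Fintype.card_pos_iff.1 (by omega)
  set I₀ := (Real.sqrt (-q))⁻¹ • W.map (Rat.cast : ℚ → ℝ) with hI₀def
  -- simplicity keeps `J` off the CM locus
  have h₁ : jMatrix Ψ ≠ I₀ := fun h ↦ not_isSimple_of_jMatrix_eq_smul Ψ hWW h (by omega) hX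
  have h₂ : jMatrix Ψ ≠ -I₀ := fun h ↦
    not_isSimple_of_jMatrix_eq_smul Ψ hWW (c := -(Real.sqrt (-q))⁻¹) (by rw [h, hI₀def, neg_smul]) (by omega) hX
  -- the three matrices
  obtain ⟨G₀, hG₀⟩ := hη.exists_ratMatrix_latticeGram
  have hG₀mem : G₀ ∈ nsGramQ Ψ := ⟨transpose_eq_neg_of_map_ratCast Ψ hG₀, by
    rw [hG₀]; exact transpose_jMatrix_mul_latticeGram_mul_jMatrix Ψ hη.1⟩
  obtain ⟨A, hA, hD0⟩ := exists_transpose_mul_add_mul_ne_zero h4 hq hWW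
  obtain ⟨hDt, hDW⟩ := transpose_mul_add_mul_props hWW hA
  set D := Wᵀ * A + A * W with hDdef
  obtain ⟨hD't, hD'W⟩ := transpose_mul_props hWW hDt hDW
  have hDmem : D ∈ nsGramQ Ψ := mem_nsGramQ_of_transpose_mul_eq Ψ h4 hW hq hWW h₁ h₂ hDt hDW
  have hD'mem : Wᵀ * D ∈ nsGramQ Ψ := mem_nsGramQ_of_transpose_mul_eq Ψ h4 hW hq hWW h₁ h₂ hD't hD'W
  -- an eigenvector of `J = ±I₀`
  have hI : I₀ * I₀ = -1 := sq_normalise_eq_neg_one hq hWW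
  have hc : I₀ * jMatrix Ψ = jMatrix Ψ * I₀ := by
    rw [hI₀def, Matrix.smul_mul, Matrix.mul_smul, (mem_endAlgRat_iff Ψ W).1 hW]
  obtain ⟨x, hx0, hx⟩ := exists_ne_zero_mulVec_eq_or hI (jMatrix_mul_jMatrix Ψ) hc
  -- determinant-type forms vanish at `(±I₀ x, x)`, the polarisation is positive there
  have van : ∀ {M : Matrix κ κ ℚ}, Mᵀ = -M → Wᵀ * M = M * W →
      (jMatrix Ψ *ᵥ x) ⬝ᵥ (M.map (Rat.cast : ℚ → ℝ) *ᵥ x) = 0 := by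
    intro M hMt hMW
    have hMt' : (M.map (Rat.cast : ℚ → ℝ))ᵀ = -M.map (Rat.cast : ℚ → ℝ) := by
      rw [← Matrix.transpose_map, hMt, Matrix.map_neg _ Rat.cast_neg]
    have hMI : I₀ᵀ * M.map (Rat.cast : ℚ → ℝ) = M.map (Rat.cast : ℚ → ℝ) * I₀ := by
      rw [hI₀def, Matrix.transpose_smul, Matrix.smul_mul, Matrix.mul_smul, ← Matrix.transpose_map,
        ← map_ratCast_mul, hMW, map_ratCast_mul]
    have key : (I₀ *ᵥ x) ⬝ᵥ (M.map (Rat.cast : ℚ → ℝ) *ᵥ x) = 0 := by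
      have e1 := mulVec_dotProduct_mulVec I₀ (M.map (Rat.cast : ℚ → ℝ)) x x
      rw [hMI, ← Matrix.mulVec_mulVec] at e1
      have e2 := dotProduct_mulVec_swap hMt' (I₀ *ᵥ x) x
      linarith
    rcases hx with hx | hx
    · rw [hx, key]
    · rw [hx, neg_dotProduct, key, neg_zero]
  have pos : 0 < (jMatrix Ψ *ᵥ x) ⬝ᵥ (G₀.map (Rat.cast : ℚ → ℝ) *ᵥ x) := by
    rw [hG₀, dotProduct_latticeGram_mulVec, jMatrix_mulVec, apply_latticeJ]
    exact hη.2.2 (Ψ x) (by simpa using hx0)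
  -- linear independence of the three matrices
  have hli : LinearIndependent ℚ ![G₀, D, Wᵀ * D] := by
    rw [Fintype.linearIndependent_iff]
    intro c hc
    simp only [Fin.sum_univ_three, Matrix.cons_val_zero, Matrix.cons_val_one, Matrix.cons_val_two,
      Matrix.head_cons, Matrix.tail_cons] at hc
    -- `c 0 = 0` by positivity
    have hc0 : c 0 = 0 := by
      have hR := congrArg (fun M : Matrix κ κ ℚ ↦ (jMatrix Ψ *ᵥ x) ⬝ᵥ (M.map (Rat.cast : ℚ → ℝ) *ᵥ x)) hc
      simp only [Matrix.map_add _ Rat.cast_add, map_ratCast_smul, Matrix.add_mulVec, Matrix.smul_mulVec,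
        dotProduct_add, dotProduct_smul, van hDt hDW, van hD't hD'W, add_zero,
        Matrix.map_zero _ Rat.cast_zero, Matrix.zero_mulVec, dotProduct_zero, smul_eq_mul, mul_zero] at hR
      have : (c 0 : ℝ) = 0 := by
        rcases mul_eq_zero.1 hR with h | h
        · exact h
        · exact absurd h pos.ne'
      exact_mod_cast this
    rw [hc0, zero_smul, zero_add] at hc
    -- `c 1 = c 2 = 0` from `D ≠ 0`
    have hWt : Wᵀ * Wᵀ = q • 1 := by
      rw [← Matrix.transpose_mul, hWW, Matrix.transpose_smul, Matrix.transpose_one]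
    have hc' : c 1 • (Wᵀ * D) + (c 2 * q) • D = 0 := by
      have := congrArg (fun M ↦ Wᵀ * M) hc
      simpa only [Matrix.mul_add, Matrix.mul_smul, ← Matrix.mul_assoc, hWt, Matrix.smul_mul, Matrix.one_mul,
        Matrix.mul_zero, smul_smul, mul_comm (c 2) q] using this
    have hkey : (c 1 * c 1 - c 2 * c 2 * q) • D = 0 := by
      have e : c 1 • (c 1 • D + c 2 • (Wᵀ * D)) - c 2 • (c 1 • (Wᵀ * D) + (c 2 * q) • D) =
          (c 1 * c 1 - c 2 * c 2 * q) • D := by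
        simp only [smul_add, smul_smul, sub_smul, mul_comm (c 2) (c 1), ← mul_assoc]
        abel
      rw [← e, hc, hc', smul_zero, smul_zero, sub_zero]
    have hsq : c 1 * c 1 - c 2 * c 2 * q = 0 := by
      by_contra h
      exact hD0 ((smul_eq_zero.1 hkey).resolve_left h)
    have h1 : c 1 = 0 := by nlinarith [mul_self_nonneg (c 1), mul_self_nonneg (c 2)]
    have h2 : c 2 = 0 := by
      rw [h1, mul_zero, zero_sub, neg_eq_zero] at hsq
      rcases mul_eq_zero.1 hsq with h | h
      · exact (mul_self_eq_zero.1 h)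
      · exact absurd h hq.ne
    intro i
    fin_cases i
    · exact hc0
    · exact h1
    · exact h2
  -- pass to the submodule
  let F : Fin 3 → nsGramQ Ψ := fun i ↦ ⟨![G₀, D, Wᵀ * D] i, by
    fin_cases i
    · exact hG₀mem
    · exact hDmem
    · exact hD'mem⟩
  have hF : LinearIndependent ℚ F :=
    LinearIndependent.of_comp (nsGramQ Ψ).subtype (by
      convert hli using 1
      funext i
      fin_cases i <;> rfl)
  simpa using hF.fintype_card_le_finrank

end Rational

/-! ## §5 Skew elements of a positive anti-involution square to negative rationals -/

section Algebra

open Literature.RingTheory.CentralSimple Literature.NumberTheory.Automorphic NumberField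

universe u

/-- **A skew element of a positive pair squares to a NEGATIVE scalar**: if `ι W = -W`, `W ≠ 0` and
`W² = r·1` (`r ∈ ℚ`) for a positive anti-involution `ι` of a finite-dimensional `ℚ`-algebra `D`, then
`r < 0` — because `0 < Tr_{D/ℚ}(L_{W'W}) = Tr(L_{-W²}) = -r·dim_ℚ D`.
[cite: Lange2023AbelianVarietiesComplex, §2.6.2 definition of a positive anti-involution (PDF p0139)] -/
theorem _root_.Literature.RingTheory.CentralSimple.IsPositiveAntiInvolution.neg_of_apply_eq_neg_of_mul_self
    {D : Type u} [Ring D] [Algebra ℚ D] [Module.Finite ℚ D] [Nontrivial D] {ι : D →ₗ[ℚ] D}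
    (h : IsPositiveAntiInvolution D ι) {W : D} (hW : ι W = -W) (hW0 : W ≠ 0) {r : ℚ}
    (hr : W * W = r • (1 : D)) : r < 0 := by
  have hp := h.trace_pos W hW0
  have h1 : leftMulTrace ℚ D (1 : D) = (finrank ℚ D : ℚ) := by
    simp only [leftMulTrace, LinearMap.coe_comp, Function.comp_apply, AlgHom.toLinearMap_apply, map_one,
      LinearMap.trace_one]
  rw [hW, neg_mul, hr, map_neg, map_smul, h1, smul_eq_mul] at hp
  have hn : (0 : ℚ) < finrank ℚ D := by exact_mod_cast finrank_pos
  nlinarith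

/-- In a `ℚ`-line every element is a rational multiple of `1`. [folklore] -/
private theorem exists_rat_smul_one_eq {K : Type} [Field K] [CharZero K] (hK : finrank ℚ K = 1) (k : K) :
    ∃ r : ℚ, r • (1 : K) = k :=
  (finrank_eq_one_iff_of_nonzero' (1 : K) one_ne_zero).1 hK k

/-- **A positive pair `(D, ι)` of the first kind on a quaternion algebra `D` over a centre `K` with
`[K : ℚ] = 1` has a non-zero skew element `W` (`W' = -W`) with `W² = r·1`, `r < 0` rational.**  (`D` is not
commutative, so `ι ≠ id` and some `z - z' ≠ 0` is skew; `W² = trd(W) W - nrd(W)` and `(W²)' = W²` force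
`trd(W) = 0`, `W² = -nrd(W) ∈ K = ℚ·1`; positivity gives the sign.)
[cite: Lange2023AbelianVarietiesComplex, §2.6.2 Thm. 2.6.5 (b), (c) (PDF p0141–p0142): `a² ∈ K` totally negative, resp. `x' = x̄`] -/
theorem _root_.Literature.RingTheory.CentralSimple.IsPositiveAntiInvolution.exists_skew_mul_self_eq_smul_of_isQuaternionAlgebra
    (K : Type) {D : Type u} [Field K] [CharZero K] [Ring D] [Algebra ℚ D] [Algebra K D] [IsQuaternionAlgebra K D]
    [Module.Finite ℚ D] {ι : D →ₗ[ℚ] D} (hpos : IsPositiveAntiInvolution D ι) (h1 : IsOfFirstKind K D ι)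
    (hK : finrank ℚ K = 1) : ∃ W : D, ι W = -W ∧ W ≠ 0 ∧ ∃ r : ℚ, r < 0 ∧ W * W = r • (1 : D) := by
  have h4 := IsQuaternionAlgebra.finrank_eq_four (K := K) (D := D)
  haveI : Nontrivial D := Module.nontrivial_of_finrank_pos (R := K) (by omega)
  -- `D` is not commutative
  have hnc : ∃ x y : D, x * y ≠ y * x := by
    by_contra h
    push Not at h
    have hcen : ∀ x : D, x ∈ Subalgebra.center K D := fun x ↦ Subalgebra.mem_center_iff.2 fun b ↦ h b x
    have htop : (⊥ : Subalgebra K D) = ⊤ := by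
      rw [eq_top_iff]
      intro x _
      have hx := hcen x
      rwa [Algebra.IsCentral.center_eq_bot K D] at hx
    have := Subalgebra.bot_eq_top_iff_finrank_eq_one.1 htop
    omega
  -- a non-zero skew element
  have hsk : ∃ W : D, ι W = -W ∧ W ≠ 0 := by
    by_contra h
    push Not at h
    have hfix : ∀ z : D, ι z = z := fun z ↦ by
      have hz : ι (z - ι z) = -(z - ι z) := by rw [map_sub, hpos.apply_apply, neg_sub]
      have := h _ hz
      rw [sub_eq_zero] at this
      exact this.symm
    obtain ⟨x, y, hxy⟩ := hnc
    exact hxy (by rw [← hfix (x * y), hpos.map_mul, hfix, hfix])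
  obtain ⟨W, hW, hW0⟩ := hsk
  refine ⟨W, hW, hW0, ?_⟩
  -- `W² ∈ K`
  have hsq := mul_self_eq_smul_sub K W
  have hιt : ι (reducedTrace K D W • W) = -(reducedTrace K D W • W) := by
    rw [Algebra.smul_def, hpos.map_mul, h1, hW, neg_mul, Algebra.commutes]
  have hsq' : W * W = -(reducedTrace K D W • W) - algebraMap K D (reducedNorm K D W) := by
    have := congrArg ι hsq
    rwa [hpos.map_mul, hW, neg_mul_neg, map_sub, hιt, h1] at this
  have htW : reducedTrace K D W • W = 0 := by
    have h2 : (2 : K) • (reducedTrace K D W • W) = 0 := by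
      rw [two_smul]
      nth_rewrite 2 [show reducedTrace K D W • W = -(reducedTrace K D W • W) by
        have e := hsq.symm.trans hsq'
        exact sub_left_injective e]
      exact add_neg_cancel _
    exact (smul_eq_zero.1 h2).resolve_left two_ne_zero
  have ht : reducedTrace K D W = 0 := by
    by_contra ht
    apply hW0
    calc W = (reducedTrace K D W)⁻¹ • (reducedTrace K D W • W) := by rw [smul_smul, inv_mul_cancel₀ ht, one_smul]
      _ = 0 := by rw [htW, smul_zero]
  rw [ht, zero_smul, zero_sub, ← map_neg] at hsq
  -- `K = ℚ · 1`
  obtain ⟨r, hr⟩ := exists_rat_smul_one_eq hK (-reducedNorm K D W)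
  have hWW : W * W = r • (1 : D) := by
    rw [hsq, ← hr, map_rat_smul (algebraMap K D) r (1 : K), map_one]
  exact ⟨r, hpos.neg_of_apply_eq_neg_of_mul_self hW hW0 hWW, hWW⟩

/-- **A positive pair of the second kind over a CM field `K` with `[K⁺ : ℚ] = 1` (an imaginary quadratic
centre) has a non-zero skew central element `W = a - ā` with `W² = r·1`, `r < 0` rational.**
[cite: Lange2023AbelianVarietiesComplex, §2.6.2 Lemma 2.6.6 (PDF p0144): the anti-involution restricts to complex conjugation on the CM centre] -/
theorem _root_.Literature.RingTheory.CentralSimple.IsPositiveAntiInvolution.exists_skew_mul_self_eq_smul_of_isCMField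
    (K : Type) {D : Type u} [Field K] [NumberField K] [IsCMField K] [Ring D] [Algebra ℚ D] [Algebra K D]
    [Module.Finite ℚ D] [Nontrivial D] {ι : D →ₗ[ℚ] D} (hpos : IsPositiveAntiInvolution D ι)
    (hconj : ∀ a : K, ι (algebraMap K D a) = algebraMap K D (IsCMField.complexConj K a))
    (hK : finrank ℚ (maximalRealSubfield K) = 1) :
    ∃ W : D, ι W = -W ∧ W ≠ 0 ∧ ∃ r : ℚ, r < 0 ∧ W * W = r • (1 : D) := by
  -- an element moved by complex conjugation
  obtain ⟨a, ha⟩ : ∃ a : K, IsCMField.complexConj K a ≠ a := by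
    by_contra h
    push Not at h
    exact IsCMField.complexConj_ne_one K (AlgEquiv.ext h)
  set W := algebraMap K D (a - IsCMField.complexConj K a) with hWdef
  have hinj : Function.Injective (algebraMap K D) := (algebraMap K D).injective
  have hW : ι W = -W := by
    rw [hWdef, hconj, map_sub, IsCMField.complexConj_apply_apply, ← map_neg, neg_sub]
  have hW0 : W ≠ 0 := by
    rw [hWdef, map_ne_zero_iff _ hinj, sub_ne_zero]
    exact ha.symm
  refine ⟨W, hW, hW0, ?_⟩
  -- `W² = (a - ā)² ∈ K⁺ = ℚ · 1`
  have hmem : (a - IsCMField.complexConj K a) ^ 2 ∈ maximalRealSubfield K := by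
    rw [← IsCMField.complexConj_eq_self_iff, map_pow, map_sub, IsCMField.complexConj_apply_apply]
    ring
  obtain ⟨r, hr⟩ := exists_rat_smul_one_eq hK ⟨_, hmem⟩
  have hk : (a - IsCMField.complexConj K a) ^ 2 = r • (1 : K) := by
    have h := congrArg Subtype.val hr
    simp only [Rat.smul_one_eq_cast, SubfieldClass.coe_ratCast] at h
    rw [← h, Rat.smul_one_eq_cast]
  have hWW : W * W = r • (1 : D) := by
    rw [hWdef, ← map_mul, ← pow_two, hk, map_rat_smul (algebraMap K D), map_one]
  exact ⟨r, hpos.neg_of_apply_eq_neg_of_mul_self hW hW0 hWW, hWW⟩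

end Algebra

/-! ## §6 Shimura's restrictions on the endomorphism algebra of a simple abelian surface -/

section Surface

open Literature.RingTheory.CentralSimple NumberField
open Literature.NumberTheory.Automorphic (IsQuaternionAlgebra IsTotallyDefinite)

variable {κ : Type} [Fintype κ] [DecidableEq κ] [Nonempty κ] {E : Type*} [NormedAddCommGroup E]
  [NormedSpace ℂ E] [FiniteDimensional ℂ E] {Ψ : (κ → ℝ) ≃L[ℝ] E} {η : E [⋀^Fin 2]→L[ℝ] ℝ}
  {G : Matrix κ κ ℚ}

omit [FiniteDimensional ℂ E] in
/-- `ℚ ⊆ K ⊆ End_ℚ(X)` is a scalar tower. [folklore] -/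
private theorem isScalarTower_rat (hX : IsSimple Ψ) :
    IsScalarTower ℚ (centerField Ψ hX) (endAlgRat Ψ) :=
  IsScalarTower.of_algebraMap_smul fun q x ↦ by
    rw [Algebra.smul_def, Algebra.algebraMap_eq_smul_one q,
      map_rat_smul (algebraMap (centerField Ψ hX) (endAlgRat Ψ)) q 1, map_one, smul_mul_assoc, one_mul]

omit [FiniteDimensional ℂ E] in
/-- `End_ℚ(X)` is a non-trivial ring (`κ` non-empty). [folklore] -/
private theorem nontrivial_endAlgRat (Ψ : (κ → ℝ) ≃L[ℝ] E) : Nontrivial (endAlgRat Ψ) :=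
  ⟨⟨0, 1, fun h ↦ zero_ne_one (congrArg Subtype.val h)⟩⟩

omit [Nonempty κ] in
/-- **`ρ(X) ≥ 3` for a simple abelian surface with an imaginary quadratic multiplication** `W ∈ End_ℚ(X)`,
`W² = q·1`, `q < 0` (§4 with `ρ(X) = dim_ℚ nsGramQ` and `|κ| = 2 dim X = 4`).
[cite: HulekLaface2019PicardNumbersAV, §5.1 Prop. 5.1, cases (1), (3), (4) of the proof] -/
theorem IsSimple.three_le_finrank_neronSeveriGroup_of_mul_self_eq_smul (hX : IsSimple Ψ)
    (hη : IsRiemannForm Ψ η) (hg : finrank ℂ E = 2) {W : Matrix κ κ ℚ} (hW : W ∈ endAlgRat Ψ) {q : ℚ}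
    (hq : q < 0) (hWW : W * W = q • 1) : 3 ≤ finrank ℤ (neronSeveriGroup Ψ) := by
  rw [finrank_neronSeveriGroup_eq_finrank_nsGramQ]
  have h4 : Fintype.card κ = 4 := by rw [card_eq_two_mul_finrank Ψ, hg]
  exact hX.three_le_finrank_nsGramQ_of_mul_self_eq_smul Ψ hη h4 hW hq hWW

omit [FiniteDimensional ℂ E] in
/-- **The quaternion case: a skew endomorphism with negative rational square.**  For a simple polarised
complex torus whose endomorphism algebra `F` is a quaternion algebra over a centre `K` with `[K : ℚ] = 1`
(so `K` is totally real and the Rosati involution is of the first kind), some `W ∈ End_ℚ(X)` has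
`W² = q·1` with `q < 0`. [cite: Lange2023AbelianVarietiesComplex, §2.6.2 Thm. 2.6.5 (b), (c) (PDF p0141–p0142)] -/
theorem IsSimple.exists_mem_endAlgRat_mul_self_eq_smul_of_isQuaternionAlgebra (hX : IsSimple Ψ)
    (hη : IsRiemannForm Ψ η) [IsTotallyReal (centerField Ψ hX)]
    [IsQuaternionAlgebra (centerField Ψ hX) (endAlgRat Ψ)] (he : finrank ℚ (centerField Ψ hX) = 1) :
    ∃ W ∈ endAlgRat Ψ, ∃ q : ℚ, q < 0 ∧ W * W = q • 1 := by
  haveI := nontrivial_endAlgRat Ψ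
  obtain ⟨G, hG⟩ := hη.exists_ratMatrix_latticeGram
  have h1k := (hX.isOfFirstKind_rosatiEnd_iff_isTotallyReal hη hG).2 ‹_›
  obtain ⟨W, -, -, r, hr, hWW⟩ :=
    (hη.isPositiveAntiInvolution_rosati hG).exists_skew_mul_self_eq_smul_of_isQuaternionAlgebra
      (centerField Ψ hX) h1k he
  exact ⟨W, W.2, r, hr, by simpa using congrArg Subtype.val hWW⟩

omit [FiniteDimensional ℂ E] in
/-- **The CM case with an imaginary quadratic centre: a skew central endomorphism with negative rational
square.**  For a simple polarised complex torus whose centre `K` is a CM field with `[K⁺ : ℚ] = 1`, some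
`W ∈ End_ℚ(X)` has `W² = q·1`, `q < 0`. [cite: Lange2023AbelianVarietiesComplex, §2.6.2 Lemma 2.6.6 (PDF p0144)] -/
theorem IsSimple.exists_mem_endAlgRat_mul_self_eq_smul_of_isCMField (hX : IsSimple Ψ)
    (hη : IsRiemannForm Ψ η) [IsCMField (centerField Ψ hX)]
    (he₀ : finrank ℚ (maximalRealSubfield (centerField Ψ hX)) = 1) :
    ∃ W ∈ endAlgRat Ψ, ∃ q : ℚ, q < 0 ∧ W * W = q • 1 := by
  haveI := nontrivial_endAlgRat Ψ
  obtain ⟨G, hG⟩ := hη.exists_ratMatrix_latticeGram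
  have hIV := hX.isAlbertTypeIV_rosatiEnd hη hG
  obtain ⟨W, -, -, r, hr, hWW⟩ :=
    (hη.isPositiveAntiInvolution_rosati hG).exists_skew_mul_self_eq_smul_of_isCMField (centerField Ψ hX)
      hIV.apply_algebraMap he₀
  exact ⟨W, W.2, r, hr, by simpa using congrArg Subtype.val hWW⟩

/-- **Shimura: no simple abelian surface is of Albert type III.**  For a simple polarised complex torus of
dimension `2` whose endomorphism algebra is a quaternion algebra over its centre, the algebra is NOT totally
definite (Hulek–Laface: "`F` is of type III, and `m := g/2e = 1` […] under the assumption that our abelian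
variety `X` be simple, one can show that these cases never occur: `X` is isogenous to a square `Y²`").
Proof here: type III would give `ρ(X) = e = 1` (Lange's table), while a skew endomorphism `W`, `W² < 0`,
forces `ρ(X) ≥ 3`. [cite: HulekLaface2019PicardNumbersAV, §5.1 Prop. 5.1, exceptional case (1) and its proof (held text p0010)]
[cite: Shimura1963AnalyticFamilies, §4 (the theorem on `End_ℚ` of the generic member; via Hulek–Laface)] -/
theorem IsSimple.not_isTotallyDefinite_of_finrank_eq_two (hX : IsSimple Ψ) (hη : IsRiemannForm Ψ η)
    (hg : finrank ℂ E = 2) [IsQuaternionAlgebra (centerField Ψ hX) (endAlgRat Ψ)] :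
    ¬ IsTotallyDefinite (centerField Ψ hX) (endAlgRat Ψ) := by
  haveI := isScalarTower_rat hX
  haveI := nontrivial_endAlgRat Ψ
  intro hdef
  -- the quaternion case of the trichotomy: `K` totally real, `e = 1`
  have h4 := IsQuaternionAlgebra.finrank_eq_four (K := centerField Ψ hX) (D := endAlgRat Ψ)
  obtain ⟨hK, he⟩ : IsTotallyReal (centerField Ψ hX) ∧ finrank ℚ (centerField Ψ hX) = 1 := by
    rcases hX.endAlgRat_trichotomy_of_finrank_eq_two hη hg with ⟨_, h1, _⟩ | ⟨hK, he, _, _⟩ | ⟨_, h1, _⟩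
    · omega
    · exact ⟨hK, he⟩
    · omega
  haveI := hK
  obtain ⟨W, hW, q, hq, hWW⟩ := hX.exists_mem_endAlgRat_mul_self_eq_smul_of_isQuaternionAlgebra hη he
  have h3 := hX.three_le_finrank_neronSeveriGroup_of_mul_self_eq_smul hη hg hW hq hWW
  rcases hX.finrank_neronSeveriGroup_eq_or_of_isQuaternionAlgebra hη with ⟨-, hρ⟩ | ⟨hind, -⟩
  · omega
  · obtain ⟨w⟩ := (inferInstance : Nonempty (InfinitePlace (centerField Ψ hX)))
    exact hdef w (hind.isSplitAtInfinite w)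

/-- **Shimura, type III excluded (Albert-pair form)**: the Rosati pair `(End_ℚ(X), ′)` of a simple abelian
surface is never of Albert type III. [cite: HulekLaface2019PicardNumbersAV, §5.1 Prop. 5.1, exceptional case (1)]
[cite: Shimura1963AnalyticFamilies, §4 (via Hulek–Laface)] -/
theorem IsSimple.not_isAlbertTypeIII_of_finrank_eq_two (hX : IsSimple Ψ) (hη : IsRiemannForm Ψ η)
    (hG : G.map (Rat.cast : ℚ → ℝ) = latticeGram Ψ η) (hg : finrank ℂ E = 2) :
    ¬ IsAlbertTypeIII (centerField Ψ hX) (endAlgRat Ψ) (rosatiEnd Ψ hη.1 hη.2.2 hG) := by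
  intro h
  haveI := h.isQuaternionAlgebra
  exact hX.not_isTotallyDefinite_of_finrank_eq_two hη hg h.isTotallyDefinite

/-- **Simple abelian surfaces with quaternion multiplication are of type II with `ρ = 3`**: if `End_ℚ(X)`
is a quaternion algebra over its centre then it is totally indefinite (over `K = ℚ`) and `ρ(X) = 3`.
[cite: HulekLaface2019PicardNumbersAV, §5.1 Prop. 5.1 (case (1) excluded) with §2.2 Prop. 2.4 (Type II: `ρ = 3e`)] -/
theorem IsSimple.isTotallyIndefinite_of_finrank_eq_two (hX : IsSimple Ψ) (hη : IsRiemannForm Ψ η)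
    (hg : finrank ℂ E = 2) [IsQuaternionAlgebra (centerField Ψ hX) (endAlgRat Ψ)] :
    IsTotallyIndefinite (centerField Ψ hX) (endAlgRat Ψ) ∧ finrank ℤ (neronSeveriGroup Ψ) = 3 := by
  haveI := isScalarTower_rat hX
  haveI := nontrivial_endAlgRat Ψ
  have h4 := IsQuaternionAlgebra.finrank_eq_four (K := centerField Ψ hX) (D := endAlgRat Ψ)
  obtain ⟨hK, he⟩ : IsTotallyReal (centerField Ψ hX) ∧ finrank ℚ (centerField Ψ hX) = 1 := by
    rcases hX.endAlgRat_trichotomy_of_finrank_eq_two hη hg with ⟨_, h1, _⟩ | ⟨hK, he, _, _⟩ | ⟨_, h1, _⟩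
    · omega
    · exact ⟨hK, he⟩
    · omega
  haveI := hK
  rcases hX.finrank_neronSeveriGroup_eq_or_of_isQuaternionAlgebra hη with ⟨hdef, -⟩ | ⟨hind, hρ⟩
  · exact absurd hdef (hX.not_isTotallyDefinite_of_finrank_eq_two hη hg)
  · exact ⟨hind, by rw [hρ, he]⟩

/-- **Shimura: the endomorphism algebra of a simple abelian surface is not an imaginary quadratic field.**
For a simple polarised complex torus of dimension `2` with CM centre `K` (then `End_ℚ(X) = K`), `[K : ℚ] = 4`
— the case `[K : ℚ] = 2` (type IV with `m = 2`, `d = 1`, `r = s = 1` in Shimura's list) does not occur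
(Hulek–Laface: "`End_ℚ(X)` contains a totally indefinite quaternion algebra `F̃` over `K₀` with `F = K ⊂ F̃`,
so that `F = K ⊂ F̃ ⊂ End_ℚ(X) = F`, contradiction"; here: it would give `ρ(X) = e₀ = 1`, while the skew
element `a - ā` forces `ρ(X) ≥ 3`). [cite: HulekLaface2019PicardNumbersAV, §5.1 Prop. 5.1, exceptional cases (3), (4) and their proof (held text p0010)]
[cite: Shimura1963AnalyticFamilies, §4 (via Hulek–Laface)] -/
theorem IsSimple.finrank_centerField_eq_four_of_isCMField_of_finrank_eq_two (hX : IsSimple Ψ)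
    (hη : IsRiemannForm Ψ η) (hg : finrank ℂ E = 2) [IsCMField (centerField Ψ hX)] :
    finrank ℚ (centerField Ψ hX) = 4 ∧ finrank (centerField Ψ hX) (endAlgRat Ψ) = 1 := by
  haveI := isScalarTower_rat hX
  haveI := nontrivial_endAlgRat Ψ
  have hnr : ¬ IsTotallyReal (centerField Ψ hX) := fun h ↦ by
    obtain ⟨w⟩ := (inferInstance : Nonempty (InfinitePlace (centerField Ψ hX)))
    exact (InfinitePlace.not_isReal_iff_isComplex.2 (IsTotallyComplex.isComplex w)) (IsTotallyReal.isReal w)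
  obtain ⟨h1, he⟩ : finrank (centerField Ψ hX) (endAlgRat Ψ) = 1 ∧
      (finrank ℚ (centerField Ψ hX) = 2 ∨ finrank ℚ (centerField Ψ hX) = 4) := by
    rcases hX.endAlgRat_trichotomy_of_finrank_eq_two hη hg with ⟨hK, _, _⟩ | ⟨hK, _, _, _⟩ | ⟨_, h1, he⟩
    · exact absurd hK hnr
    · exact absurd hK hnr
    · exact ⟨h1, he⟩
  refine ⟨?_, h1⟩
  rcases he with he | he
  · exfalso
    have he₀ : finrank ℚ (maximalRealSubfield (centerField Ψ hX)) = 1 := by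
      have := hX.finrank_centerField_eq_two_mul; omega
    obtain ⟨W, hW, q, hq, hWW⟩ := hX.exists_mem_endAlgRat_mul_self_eq_smul_of_isCMField hη he₀
    have h3 := hX.three_le_finrank_neronSeveriGroup_of_mul_self_eq_smul hη hg hW hq hWW
    have hρ := hX.finrank_neronSeveriGroup_of_isCMField hη
    rw [he₀, h1] at hρ
    omega
  · exact he

/-- **The Shimura-sharp classification of the endomorphism algebra of a simple abelian surface** (Lange
§5.1.5 Exercise (2)(b) with Shimura's two exclusions): for a simple polarised complex torus of dimension `2`
with `F = End_ℚ(X)`, centre `K`, EXACTLY ONE of: (i) `K` totally real, `F = K`, `[K : ℚ] ∈ {1, 2}`;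
(ii) `K` totally real with `[K : ℚ] = 1`, `F` a totally INDEFINITE quaternion algebra over `K`;
(iii) `K` a CM field with `[K : ℚ] = 4` and `F = K`.
[cite: HulekLaface2019PicardNumbersAV, §5.1 Prop. 5.1 (exceptional cases (1), (3), (4) excluded for simple `X`)]
[cite: Lange2023AbelianVarietiesComplex, §5.1.5 Exercise (2)(b) (PDF p0250 L2–L9)] [cite: Shimura1963AnalyticFamilies, §4 (via Hulek–Laface)] -/
theorem IsSimple.endAlgRat_trichotomy_of_finrank_eq_two' (hX : IsSimple Ψ) (hη : IsRiemannForm Ψ η)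
    (hg : finrank ℂ E = 2) :
    (IsTotallyReal (centerField Ψ hX) ∧ finrank (centerField Ψ hX) (endAlgRat Ψ) = 1 ∧
        (finrank ℚ (centerField Ψ hX) = 1 ∨ finrank ℚ (centerField Ψ hX) = 2)) ∨
      (IsTotallyReal (centerField Ψ hX) ∧ finrank ℚ (centerField Ψ hX) = 1 ∧
        IsQuaternionAlgebra (centerField Ψ hX) (endAlgRat Ψ) ∧
          IsTotallyIndefinite (centerField Ψ hX) (endAlgRat Ψ)) ∨
      (IsCMField (centerField Ψ hX) ∧ finrank (centerField Ψ hX) (endAlgRat Ψ) = 1 ∧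
        finrank ℚ (centerField Ψ hX) = 4) := by
  rcases hX.endAlgRat_trichotomy_of_finrank_eq_two hη hg with h | ⟨hK, he, hQ, -⟩ | ⟨hK, h1, -⟩
  · exact Or.inl h
  · haveI := hQ
    exact Or.inr (Or.inl ⟨hK, he, hQ, (hX.isTotallyIndefinite_of_finrank_eq_two hη hg).1⟩)
  · haveI := hK
    exact Or.inr (Or.inr ⟨hK, h1, (hX.finrank_centerField_eq_four_of_isCMField_of_finrank_eq_two hη hg).1⟩)

/-- **Picard number and endomorphism rank of a simple abelian surface: `(ρ(X), dim_ℚ End_ℚ(X)) ∈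
{(1,1), (2,2), (3,4), (2,4)}`** (type I with `e = 1, 2`; type II; type IV with a CM quartic field) — the
lines `(1, 4)` (type III) and `(1, 2)` (imaginary quadratic) of the unrestricted table do not occur.
[cite: HulekLaface2019PicardNumbersAV, §2.2 Prop. 2.4 (`k = 1`) with §5.1 Prop. 5.1]
[cite: Lange2023AbelianVarietiesComplex, §2.6.1 Proposition, table (PDF p0138) with §5.1.5 Exercise (2)(b)] -/
theorem IsSimple.finrank_neronSeveriGroup_and_finrank_endAlgRat_of_finrank_eq_two (hX : IsSimple Ψ)
    (hη : IsRiemannForm Ψ η) (hg : finrank ℂ E = 2) :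
    (finrank ℤ (neronSeveriGroup Ψ) = 1 ∧ finrank ℚ (endAlgRat Ψ) = 1) ∨
      (finrank ℤ (neronSeveriGroup Ψ) = 2 ∧ finrank ℚ (endAlgRat Ψ) = 2) ∨
      (finrank ℤ (neronSeveriGroup Ψ) = 3 ∧ finrank ℚ (endAlgRat Ψ) = 4) ∨
      (finrank ℤ (neronSeveriGroup Ψ) = 2 ∧ finrank ℚ (endAlgRat Ψ) = 4) := by
  haveI := isScalarTower_rat hX
  haveI := nontrivial_endAlgRat Ψ
  obtain ⟨G, hG⟩ := hη.exists_ratMatrix_latticeGram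
  have hdim : finrank ℚ (endAlgRat Ψ) =
      finrank ℚ (centerField Ψ hX) * finrank (centerField Ψ hX) (endAlgRat Ψ) :=
    (Module.finrank_mul_finrank ℚ (centerField Ψ hX) (endAlgRat Ψ)).symm
  rcases hX.isAlbertType_of_finrank_eq_two hη hG hg with h | h | h | h
  · -- type I: `ρ = e ∈ {1, 2}`, `F = K`
    haveI := h.isTotallyReal
    have hρ := hX.finrank_neronSeveriGroup_of_isAlbertTypeI hη hG h
    have hedvd : finrank ℚ (centerField Ψ hX) ∣ 2 := hg ▸ hX.finrank_centerField_dvd_of_isTotallyReal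
    have hele := Nat.le_of_dvd two_pos hedvd
    have he : 0 < finrank ℚ (centerField Ψ hX) := finrank_pos
    rw [h.finrank_eq_one, mul_one] at hdim
    interval_cases (finrank ℚ (centerField Ψ hX))
    · exact Or.inl ⟨hρ, hdim⟩
    · exact Or.inr (Or.inl ⟨hρ, hdim⟩)
  · -- type II: `ρ = 3e`, `e = 1`, `[F : K] = 4`
    haveI := h.isQuaternionAlgebra
    obtain ⟨-, hρ⟩ := hX.isTotallyIndefinite_of_finrank_eq_two hη hg
    have h4 := IsQuaternionAlgebra.finrank_eq_four (K := centerField Ψ hX) (D := endAlgRat Ψ)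
    obtain ⟨-, he⟩ : IsTotallyReal (centerField Ψ hX) ∧ finrank ℚ (centerField Ψ hX) = 1 := by
      rcases hX.endAlgRat_trichotomy_of_finrank_eq_two hη hg with ⟨_, h1, _⟩ | ⟨hK, he, _, _⟩ | ⟨_, h1, _⟩
      · omega
      · exact ⟨hK, he⟩
      · omega
    rw [he, h4] at hdim
    exact Or.inr (Or.inr (Or.inl ⟨hρ, hdim⟩))
  · -- type III: excluded
    exact absurd h (hX.not_isAlbertTypeIII_of_finrank_eq_two hη hG hg)
  · -- type IV: `K` a CM quartic field, `F = K`, `ρ = e₀ = 2`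
    haveI := h.isCMField
    obtain ⟨he, h1⟩ := hX.finrank_centerField_eq_four_of_isCMField_of_finrank_eq_two hη hg
    have hρ := hX.finrank_neronSeveriGroup_of_isCMField hη
    have he₀ : finrank ℚ (maximalRealSubfield (centerField Ψ hX)) = 2 := by
      have := hX.finrank_centerField_eq_two_mul; omega
    rw [he₀, h1, mul_one] at hρ
    rw [he, h1, mul_one] at hdim
    exact Or.inr (Or.inr (Or.inr ⟨hρ, hdim⟩))

/-- **A simple abelian surface of Picard number one has `End_ℚ(X) = ℚ`** (`dim_ℚ End_ℚ(X) = 1`; the competing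
lines `ρ = 1` of types III and IV-imaginary-quadratic are Shimura's excluded cases).
[cite: HulekLaface2019PicardNumbersAV, §5.1 Prop. 5.1 with §2.2 Prop. 2.4] -/
theorem IsSimple.finrank_endAlgRat_eq_one_of_finrank_neronSeveriGroup_eq_one (hX : IsSimple Ψ)
    (hη : IsRiemannForm Ψ η) (hg : finrank ℂ E = 2) (h1 : finrank ℤ (neronSeveriGroup Ψ) = 1) :
    finrank ℚ (endAlgRat Ψ) = 1 := by
  rcases hX.finrank_neronSeveriGroup_and_finrank_endAlgRat_of_finrank_eq_two hη hg with
    ⟨-, h⟩ | ⟨h', -⟩ | ⟨h', -⟩ | ⟨h', -⟩ <;> omega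

/-- **An imaginary quadratic multiplication on a simple abelian surface forces quaternion multiplication**:
if `W ∈ End_ℚ(X)` with `W² = q·1`, `q < 0`, then `ρ(X) = 3` and the Rosati pair is of Albert type II
(Shimura's case (4): "`End_ℚ(X)` contains a totally indefinite quaternion algebra").
[cite: HulekLaface2019PicardNumbersAV, §5.1 Prop. 5.1, exceptional case (4) and its proof] -/
theorem IsSimple.finrank_neronSeveriGroup_eq_three_of_mul_self_eq_smul (hX : IsSimple Ψ)
    (hη : IsRiemannForm Ψ η) (hG : G.map (Rat.cast : ℚ → ℝ) = latticeGram Ψ η) (hg : finrank ℂ E = 2)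
    {W : Matrix κ κ ℚ} (hW : W ∈ endAlgRat Ψ) {q : ℚ} (hq : q < 0) (hWW : W * W = q • 1) :
    finrank ℤ (neronSeveriGroup Ψ) = 3 ∧
      IsAlbertTypeII (centerField Ψ hX) (endAlgRat Ψ) (rosatiEnd Ψ hη.1 hη.2.2 hG) := by
  have h3 := hX.three_le_finrank_neronSeveriGroup_of_mul_self_eq_smul hη hg hW hq hWW
  have hle : finrank ℤ (neronSeveriGroup Ψ) ≤ 3 := by
    rcases hX.finrank_neronSeveriGroup_of_finrank_eq_two hη hg with h | h | h <;> omega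
  have hρ : finrank ℤ (neronSeveriGroup Ψ) = 3 := le_antisymm hle h3
  exact ⟨hρ, (hX.finrank_neronSeveriGroup_eq_three_iff_of_finrank_eq_two hη hG hg).1 hρ⟩

/-- `2·C(n, 2) + n = n²`. [folklore] -/
private theorem two_mul_choose_two_add (n : ℕ) : 2 * n.choose 2 + n = n * n := by
  induction n with
  | zero => simp
  | succ m ih =>
    rw [Nat.choose_succ_succ, Nat.choose_one_right]
    nlinarith [ih]

/-- **The Picard numbers of the powers of a simple abelian surface** (Murty / Hulek–Laface Prop. 2.4 at
`dim A = 2`, with Shimura's exclusions): `ρ(Xⁿ) ∈ {½n(n+1), n(n+1), n(2n+1), 2n²}` — the four surviving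
lines (type I with `e = 1`: `½ek(k+1)`; type I with `e = 2`; type II with `e = 1`: `ek(2k+1)`; type IV
with `e = 4, d = 1`: `½ed²k²`); the type-III value `n(2n-1)` and the imaginary-quadratic value `n²` do not
occur.  From `ρ(Xⁿ) = nρ(X) + C(n,2)·dim_ℚ End_ℚ(X)` (Cor. 2.5) and the list `(ρ, dim) ∈ {(1,1),(2,2),(3,4),(2,4)}`.
[cite: HulekLaface2019PicardNumbersAV, §2.2 Prop. 2.4 and Cor. 2.5 (held text p0006) with §5.1 Prop. 5.1] -/
theorem IsSimple.finrank_neronSeveriGroup_pow_of_finrank_eq_two (hX : IsSimple Ψ) (hA : IsAbelianVariety Ψ)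
    (hg : finrank ℂ E = 2) (n : ℕ) :
    2 * finrank ℤ (neronSeveriGroup (powPeriod Ψ n)) = n * (n + 1) ∨
      finrank ℤ (neronSeveriGroup (powPeriod Ψ n)) = n * (n + 1) ∨
      finrank ℤ (neronSeveriGroup (powPeriod Ψ n)) = n * (2 * n + 1) ∨
      finrank ℤ (neronSeveriGroup (powPeriod Ψ n)) = 2 * n ^ 2 := by
  have hρn := hA.finrank_neronSeveriGroup_pow n
  obtain ⟨η, hη⟩ := hA
  have hc := two_mul_choose_two_add n
  have e1 : n * (n + 1) = n * n + n := by ring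
  have e2 : n * (2 * n + 1) = 2 * (n * n) + n := by ring
  have e3 : 2 * n ^ 2 = 2 * (n * n) := by ring
  rcases hX.finrank_neronSeveriGroup_and_finrank_endAlgRat_of_finrank_eq_two hη hg with
    ⟨hρ, hd⟩ | ⟨hρ, hd⟩ | ⟨hρ, hd⟩ | ⟨hρ, hd⟩ <;> rw [hρ, hd] at hρn
  · exact Or.inl (by rw [hρn, e1]; omega)
  · exact Or.inr (Or.inl (by rw [hρn, e1]; omega))
  · exact Or.inr (Or.inr (Or.inl (by rw [hρn, e2]; omega)))
  · exact Or.inr (Or.inr (Or.inr (by rw [hρn, e3]; omega)))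

end Surface

end ComplexTorus

end Literature.Geometry.Kaehler
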